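import Summits.NavierStokesRegularity.NavierStokesRegularity.Theses.PlaneEnergyCeiling
import Summits.NavierStokesRegularity.NavierStokesRegularity.Theorems.PlaneEnergyCeilingBoundedPlanarEnergyRegularityStubPlanarEnergyZoom

/-!
# Route PlaneEnergyCeiling · support `PlanarEnergyZoom` (stmt-NavierStokesRegularity-16858) — proved

The extension-form velocity-record zoom at bounded planar energy, `PlanarEnergyZoom` (support item
of the route `PlaneEnergyCeiling`), is verbatim the landed zoom stub
`BoundedPlanarEnergyRegularity.stub_planarEnergyZoom` of the sibling crux
`BoundedPlanarEnergyRegularity`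
(`Theorems/PlaneEnergyCeilingBoundedPlanarEnergyRegularityStubPlanarEnergyZoom.lean`; KNSS 2009
Prop. 6.1 zoom at near-record points with `ν` normalised to `1`, Oseen identity in the limit,
planar Fatou). This file records the item-closing theorem with the route decl as its type.

References: Koch–Nadirashvili–Seregin–Šverák 2009 (Prop. 6.1); Seregin–Šverák 2009;
Albritton–Barker 2019. [KNSS2009] [SereginSverak2009]
-/

noncomputable section

-- single-conjunct summit: `Summit.<Summit>.<Problem>` repeats the name by the D-0017 layout
set_option linter.dupNamespace false

namespace Summit.NavierStokesRegularity.NavierStokesRegularity.Theorems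

/-- **Support item `PlanarEnergyZoom` (stmt-NavierStokesRegularity-16858), proved**: a classical
Leray–Hopf solution from a rapidly decaying datum with no smooth extension past `T` and planar
energies `≤ M` on `[0,T)` yields a non-zero bounded ancient mild solution (`ν = 1`), measurable,
jointly smooth on `(−∞,0) × ℝ³`, with uniformly bounded planar energies — by
`BoundedPlanarEnergyRegularity.stub_planarEnergyZoom`. -/
theorem planarEnergyZoom_proof :
    Summit.NavierStokesRegularity.NavierStokesRegularity.Theses.PlaneEnergyCeiling.PlanarEnergyZoom :=
  BoundedPlanarEnergyRegularity.stub_planarEnergyZoom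

end Summit.NavierStokesRegularity.NavierStokesRegularity.Theorems

end
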